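import Summits.HodgeConjecture.HodgeConjecture.Theorems.F0P3cStCharTSHyperbolicSet        -- ★ (F0P3a-p05) `hyperbolicSet` is conjugation-invariant and regular (brings ★ TorusDefs `hyperbolicSet`)
import Summits.HodgeConjecture.HodgeConjecture.Theorems.F0P3cStCharTSTypeThreeLink         -- ★ (LH1-p03) the type-(3) torus: regular elements have NO eigenvalue in `L ⊗ L⁺_v`
import Summits.HodgeConjecture.HodgeConjecture.Theorems.F0P3cStCharTSEllipticCriterion     -- ★ (F0P2-p02) (E1) conjugate into `M` ⇒ an eigenvalue in `L ⊗ L⁺_v`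
import Literature.NumberTheory.Rogawski1990.Ch12Sec5Inputs                                 -- ★ `EllipticData` and the (S-𝔇) vocabulary
import HarnessLib

/-!
# F0 · P3c · line LH6 «StCharTS» — «ELL-FIELD★»: the ELLIPTIC-REGULAR SET `G^e` of the §12.5 datum on `U(Φ₃)(L⁺_v)` and the (S-𝔇) conjuncts
# (E⊆R), (SPLIT-NOT-ELL), (T3) AS THEOREMS at every datum whose `ellG` is «regular and NOT conjugate into the split torus `M`» (datum road, slice 2)

Cell `pub/hodgecm-mathlib`, crux H413 = `stmt-HodgeConjecture-24833` (lane `--supports …`), route HCCMUnconditional; seat LH6-p01 (g4).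
THEOREMS ONLY (no definition ∕ instance ∕ notation ∕ named fact ∕ `sorry`); ★-only imports.

WHAT.  Print's `G^e ⊆ G^r` (§12.5 p. 184) is the set of regular ELLIPTIC elements: the regular `γ` whose Cartan subgroup is anisotropic modulo the
centre.  For the quasi-split `U(3)` (of `F`-rank one) a Cartan subgroup is non-elliptic iff it is conjugate to the diagonal torus `M ≅ E^× × E¹`, so
`G^e = G^r ∖ Ω` with `Ω` = ★ `hyperbolicSet` (the conjugates of the regular elements of `M`).  The (S-𝔇) organ `stub_EllipticPackage` of
`Cruxes/H413/Lines/F0_P3c_StCharTSPaydown.lean` carries three conjuncts that become THEOREMS the moment the datum's `ellG` IS this set and its `regG` is the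
organ's regular set (the COMPAT clause `γ ∈ 𝔇.regG ↔ IsRegularElt γ`): the definition-level coherence (E⊆R) `𝔇.ellG ⊆ 𝔇.regG`, the structural
socket (SPLIT-NOT-ELL) «a regular element of `M` is not in `G^e`» [§12.5 p. 184], and (T3) «the regular elements of a Cartan subgroup `T` of type (3) are
elliptic and their characteristic polynomials have no eigenvalue from `U(Φ₁)(L⁺_v)`» [L. 12.7.2 (proof) p. 194; §3.6] — the last over ★ «T3-LINK»
`exists_typeThree_torus_not_isRoot_all` (LH1-p03) and ★ «ELL-CRIT» (E1) `exists_isRoot_charpoly_of_conj_mem_torusU` (F0P2-p02).  Both hypotheses are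
stated as `↔`-clauses on an ABSTRACT `𝔇` (no definition is introduced), exactly as the datum constructor will discharge them (`Iff.rfl`).
HONEST LABEL: HC_CM is proved only modulo the 7 printed citations (2 remaining named inputs: hLiu418 = `stmt-HodgeConjecture-24832`, h413 =
`stmt-HodgeConjecture-24833`) until rung 0 closes; this file closes no organ — it pays (E⊆R), (SPLIT-NOT-ELL) and (T3) of (S-𝔇) at the future CONCRETE
datum (count-neutral until the datum is built).

## References
* [Rogawski1990] J. D. Rogawski, *Automorphic Representations of Unitary Groups in Three Variables*, Ann. of Math. Stud. 123 (1990): §3.6 pp. 29–31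
  (Cartan subgroups of `U(3)`, types (0)–(3)); §12.5 pp. 182–184 (`G^r`, `G^e`); Lemma 12.7.2 (proof) p. 194 («let `T` be a Cartan subgroup of type (3)»).
-/

set_option autoImplicit false
-- the mandated namespace has the single-problem summit's repeated segment (`HodgeConjecture.HodgeConjecture`)
set_option linter.dupNamespace false

noncomputable section

open NumberField IsDedekindDomain MeasureTheory
open scoped Matrix MatrixGroups
open Literature.NumberTheory.Rogawski1990 Literature.NumberTheory.Automorphic Literature.NumberTheory.Automorphic.UnitaryGroup
open Literature.NumberTheory.Rogawski1990.Ch12Sec5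
open Summit.HodgeConjecture.HodgeConjecture.Cruxes.H413.F0P3cStCharTSTorusDefs
open Summit.HodgeConjecture.HodgeConjecture.Cruxes.H413.F0P3cStCharTSHyperbolicSet

namespace Summit.HodgeConjecture.HodgeConjecture.Cruxes.H413.F0P3cStCharTSEllField

variable (L : Type) [Field L] [NumberField L] [IsCMField L] (v : HeightOneSpectrum (𝓞 ↥(maximalRealSubfield L)))

/-! ## §1 The set `G^r ∖ Ω` (regular, not conjugate into `M`): membership tests -/

/-- A regular element of the diagonal torus `M` lies in `Ω` (it is conjugate to itself). [cite: Rogawski1990, §12.5 p. 184] -/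
theorem coe_mem_hyperbolicSet_of_isRegularElt (t : ↥(cmBorelTriple L 3 v).M)
    (ht : IsRegularElt ((((t : ↥(unitaryGroupOfForm (conjLocal L (IsCMField.complexConj L) v) (cmLocalForm L 3 v))) : Gqs L v).val :
      GL (Fin 3) (UnitaryGroup.LocalRing L v)))) :
    ((t : ↥(unitaryGroupOfForm (conjLocal L (IsCMField.complexConj L) v) (cmLocalForm L 3 v))) : Gqs L v) ∈ hyperbolicSet L v :=
  ⟨t, ht, IsConj.refl _⟩

/-- An element of `Ω` has an eigenvalue in `L ⊗ L⁺_v` (it is conjugate to a diagonal element; ★ (E1)). [cite: Rogawski1990, §3.6; §12.5 p. 184] -/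
theorem exists_isRoot_charpoly_of_mem_hyperbolicSet {g : Gqs L v} (hg : g ∈ hyperbolicSet L v) :
    ∃ c : UnitaryGroup.LocalRing L v, ((g.val.val : Matrix (Fin 3) (Fin 3) (UnitaryGroup.LocalRing L v)).charpoly).IsRoot c := by
  obtain ⟨t, -, hc⟩ := hg
  obtain ⟨x, hx⟩ := isConj_iff.1 hc
  -- read `g`, `x` in the subtype group `U(Φ₃)(L⁺_v)` (the carrier of `Gqs L v`, definitionally); `x t x⁻¹ = g`, so `x⁻¹ g x = t ∈ M`
  let g' : ↥(unitaryGroupOfForm (conjLocal L (IsCMField.complexConj L) v) (cmLocalForm L 3 v)) := g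
  let x' : ↥(unitaryGroupOfForm (conjLocal L (IsCMField.complexConj L) v) (cmLocalForm L 3 v)) := x
  have hx' : x' * (t : ↥(unitaryGroupOfForm (conjLocal L (IsCMField.complexConj L) v) (cmLocalForm L 3 v))) * x'⁻¹ = g' := hx
  have hmem : x'⁻¹ * g' * x'⁻¹⁻¹ ∈ torusU (conjLocal L (IsCMField.complexConj L) v) (cmLocalForm L 3 v) := by
    have h1 : x'⁻¹ * g' * x'⁻¹⁻¹ = (t : ↥(unitaryGroupOfForm (conjLocal L (IsCMField.complexConj L) v) (cmLocalForm L 3 v))) := by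
      rw [← hx']; group
    rw [h1]
    exact t.2
  exact F0P3cStCharTSEllipticCriterion.exists_isRoot_charpoly_of_conj_mem_torusU
    (conjLocal L (IsCMField.complexConj L) v) (cmLocalForm L 3 v) hmem

/-- NO eigenvalue in `L ⊗ L⁺_v` ⇒ not in `Ω`. [cite: Rogawski1990, §3.6; §12.5 p. 184] -/
theorem not_mem_hyperbolicSet_of_forall_not_isRoot {g : Gqs L v}
    (h : ∀ c : UnitaryGroup.LocalRing L v, ¬ ((g.val.val : Matrix (Fin 3) (Fin 3) (UnitaryGroup.LocalRing L v)).charpoly).IsRoot c) :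
    g ∉ hyperbolicSet L v := fun hg => by
  obtain ⟨c, hc⟩ := exists_isRoot_charpoly_of_mem_hyperbolicSet L v hg
  exact h c hc

/-! ## §2 The three (S-𝔇) conjuncts at a datum with `ellG = G^r ∖ Ω` -/

section Datum

variable [MeasurableSpace (Gqs L v)]
  [∀ γ : Gqs L v, MeasurableSpace (Gqs L v ⧸ Subgroup.centralizer ({γ} : Set (Gqs L v)))]
  [MeasurableSpace (Gqs L v ⧸ Subgroup.center (Gqs L v))]
  {H' : Type} [Group H'] [TopologicalSpace H'] [IsTopologicalGroup H'] [MeasurableSpace H']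

/-- **(E⊆R) `G^e ⊆ G^r`** at any datum whose `ellG` is «regular and not in `Ω`» and whose `regG` is the organ's regular set.
[cite: Rogawski1990, §12.5 p. 184] -/
theorem ellG_subset_regG (𝔇 : EllipticData (Gqs L v) H')
    (hR : ∀ γ : Gqs L v, γ ∈ 𝔇.regG ↔ IsRegularElt (γ.val : GL (Fin 3) (UnitaryGroup.LocalRing L v)))
    (hE : ∀ γ : Gqs L v, γ ∈ 𝔇.ellG ↔ IsRegularElt (γ.val : GL (Fin 3) (UnitaryGroup.LocalRing L v)) ∧ γ ∉ hyperbolicSet L v) :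
    𝔇.ellG ⊆ 𝔇.regG :=
  fun γ hγ => (hR γ).2 ((hE γ).1 hγ).1

/-- **`G^e` is conjugation-invariant** at such a datum (regularity and `Ω` are class-invariant). [cite: Rogawski1990, §12.5 p. 184] -/
theorem conj_mem_ellG_iff (𝔇 : EllipticData (Gqs L v) H')
    (hE : ∀ γ : Gqs L v, γ ∈ 𝔇.ellG ↔ IsRegularElt (γ.val : GL (Fin 3) (UnitaryGroup.LocalRing L v)) ∧ γ ∉ hyperbolicSet L v)
    (γ x : Gqs L v) : x * γ * x⁻¹ ∈ 𝔇.ellG ↔ γ ∈ 𝔇.ellG := by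
  rw [hE, hE, conj_mem_hyperbolicSet_iff]
  exact and_congr_left'
    (F0P3cStCharTSEllipticCriterion.isRegularElt_coe_conj_iff (conjLocal L (IsCMField.complexConj L) v) (cmLocalForm L 3 v) γ x)

/-- **(SPLIT-NOT-ELL), TOKEN FOR TOKEN** — «a REGULAR element of the split torus `M ⊂ U(Φ₃)(L⁺_v)` is not in `G^e`» at any datum whose `ellG` is
«regular and not in `Ω`». [cite: Rogawski1990, §12.5 p. 184] -/
theorem splitNotEll (𝔇 : EllipticData (Gqs L v) H')
    (hE : ∀ γ : Gqs L v, γ ∈ 𝔇.ellG ↔ IsRegularElt (γ.val : GL (Fin 3) (UnitaryGroup.LocalRing L v)) ∧ γ ∉ hyperbolicSet L v) :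
    ∀ t : ↥(cmBorelTriple L 3 v).M,
      IsRegularElt ((((t : ↥(unitaryGroupOfForm (conjLocal L (IsCMField.complexConj L) v) (cmLocalForm L 3 v))) : Gqs L v).val :
        GL (Fin 3) (UnitaryGroup.LocalRing L v))) →
      ((t : ↥(unitaryGroupOfForm (conjLocal L (IsCMField.complexConj L) v) (cmLocalForm L 3 v))) : Gqs L v) ∉ 𝔇.ellG :=
  fun t ht hmem => ((hE _).1 hmem).2 (coe_mem_hyperbolicSet_of_isRegularElt L v t ht)

/-- **(T3), TOKEN FOR TOKEN, with the torus supplied** — at a NON-SPLIT place: there is a subgroup `T ≤ U(Φ₃)(L⁺_v)` (the type-(3) Cartan subgroup of ★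
«T3-LINK») containing a regular element, such that at any datum whose `ellG` is «regular and not in `Ω`» and whose `regG` is the organ's regular set,
every regular `γ ∈ T` is in `G^e` and its characteristic polynomial has no eigenvalue from `U(Φ₁)(L⁺_v)`.
[cite: Rogawski1990, §3.6; Lemma 12.7.2 (proof) p. 194] -/
theorem exists_typeThree_T3 (hv : ∀ w : PlacesOver L v, IsCMField.complexConj L • w.1 = w.1) :
    ∃ T : Subgroup (Gqs L v),
      (∃ γ ∈ T, IsRegularElt (γ.val : GL (Fin 3) (UnitaryGroup.LocalRing L v))) ∧
      ∀ 𝔇 : EllipticData (Gqs L v) H',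
        (∀ γ : Gqs L v, γ ∈ 𝔇.regG ↔ IsRegularElt (γ.val : GL (Fin 3) (UnitaryGroup.LocalRing L v))) →
        (∀ γ : Gqs L v, γ ∈ 𝔇.ellG ↔ IsRegularElt (γ.val : GL (Fin 3) (UnitaryGroup.LocalRing L v)) ∧ γ ∉ hyperbolicSet L v) →
        ∀ γ ∈ T, γ ∈ 𝔇.regG → γ ∈ 𝔇.ellG ∧
          ∀ z : (UnitaryGroup.cmDatum L 1 (Matrix.of fun i j : Fin 1 => if i.val + j.val + 1 = 1 then (1 : L) else 0)).Local v,
            ¬ ((γ.val.val : Matrix (Fin 3) (Fin 3) (UnitaryGroup.LocalRing L v)).charpoly).IsRoot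
              (((z.val.val : Matrix (Fin 1) (Fin 1) (UnitaryGroup.LocalRing L v))) 0 0) := by
  obtain ⟨T, hT, hall⟩ := F0P3cStCharTSTypeThreeLink.exists_typeThree_torus_not_isRoot_all L v hv
  refine ⟨T, hT, fun 𝔇 hR hE γ hγ hreg => ?_⟩
  have hreg' : IsRegularElt (γ.val : GL (Fin 3) (UnitaryGroup.LocalRing L v)) := (hR γ).1 hreg
  exact ⟨(hE γ).2 ⟨hreg', not_mem_hyperbolicSet_of_forall_not_isRoot L v (hall γ hγ hreg')⟩, fun z => hall γ hγ hreg' _⟩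

end Datum

end Summit.HodgeConjecture.HodgeConjecture.Cruxes.H413.F0P3cStCharTSEllField

end
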